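import Mathlib
import Literature.Analysis.FluidPDE.PeriodicCylinderCoordinates
import HarnessLib

/-!
# Integration engine on `ℝ³` for the flux-sign stub (crux `DyadicRealisation`, line Sketch)

Tools file for `stub_fluxSign` of
`Summit.AnomalousDissipation.AnomalousDissipation.Theses.DyadicWallCascade.DyadicRealisation`:
coordinates `ℝ³ ≃ ℝ × ℝ × ℝ` for the Bochner integral, splitting of product integrands, the
mirror reflection `X ↦ X − 2X₂e₂` as a measure-preserving map, compact support from coordinate
bounds, horizontal telescoping of plateau cut-offs against bi-periodic integrands, and the
unit-cell averaging identities `∫ κ h = ∫₀¹ h`, `∫∫ κ⊗κ h = ∫_{[0,1]²} h` for a partition-of-unity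
profile `κ`.  All statements are folklore calculus; the file ends with the registered tools stub
`stub_fluxSignTools` (conjunction of the helper statements).
-/

open MeasureTheory Set Filter Topology Function
open scoped BigOperators

set_option linter.dupNamespace false

namespace Summit.AnomalousDissipation.AnomalousDissipation.Theorems

/-- Coordinates for the Bochner integral on `ℝ³`: `∫ f = ∫_{(z,(a,b)) ∈ ℝ × ℝ × ℝ} f(a,b,z)`
(Lebesgue measure on `EuclideanSpace ℝ (Fin 3)` is the image of the product measure; no
integrability hypothesis, both sides being images under a measurable equivalence). [folklore] -/
theorem fluxSign_integral_coord (f : EuclideanSpace ℝ (Fin 3) → ℝ) :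
    ∫ Y, f Y = ∫ w : ℝ × ℝ × ℝ, f !₂[w.2.1, w.2.2, w.1] := by
  have h1 := (PiLp.volume_preserving_toLp (Fin 3)).integral_comp
    (MeasurableEquiv.toLp 2 (Fin 3 → ℝ)).measurableEmbedding f
  rw [← h1]
  have h2 := (Literature.Analysis.FluidPDE.volume_preserving_cylParamEquiv).symm.integral_comp
    Literature.Analysis.FluidPDE.cylParamEquiv.symm.measurableEmbedding
    (fun y : Fin 3 → ℝ => f (WithLp.toLp 2 y))
  rw [← h2]
  congr 1
  funext w
  obtain ⟨z, a, b⟩ := w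
  rw [Literature.Analysis.FluidPDE.cylParamEquiv_symm_apply]

/-- Splitting of a product integrand on `ℝ³`: `∫ g(Y₀,Y₁) h(Y₂) dY = (∫_{ℝ²} g) (∫_ℝ h)`
(no integrability needed, Mathlib `integral_prod_mul`). [folklore] -/
theorem fluxSign_integral_mul_split (g : ℝ × ℝ → ℝ) (h : ℝ → ℝ) :
    ∫ Y : EuclideanSpace ℝ (Fin 3), g (Y 0, Y 1) * h (Y 2) = (∫ q : ℝ × ℝ, g q) * ∫ s : ℝ, h s := by
  rw [fluxSign_integral_coord]
  have : (fun w : ℝ × ℝ × ℝ =>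
      g ((!₂[w.2.1, w.2.2, w.1] : EuclideanSpace ℝ (Fin 3)) 0,
        (!₂[w.2.1, w.2.2, w.1] : EuclideanSpace ℝ (Fin 3)) 1) *
        h ((!₂[w.2.1, w.2.2, w.1] : EuclideanSpace ℝ (Fin 3)) 2)) =
      fun w : ℝ × ℝ × ℝ => h w.1 * g w.2 := by
    funext w
    simp [mul_comm]
  rw [this, mul_comm]
  exact integral_prod_mul (μ := volume) (ν := volume) h g

/-- The mirror reflection `X ↦ X − 2X₂ e₂` in the plane `X₂ = 0` preserves Lebesgue measure on
`ℝ³`: `∫ f(σX) dX = ∫ f` (it is the linear isometry negating the third coordinate). [folklore] -/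
theorem fluxSign_integral_reflect (f : EuclideanSpace ℝ (Fin 3) → ℝ) :
    ∫ Y : EuclideanSpace ℝ (Fin 3), f (Y - (2 * Y 2) • EuclideanSpace.single 2 (1 : ℝ)) =
      ∫ Y, f Y := by
  set σ : EuclideanSpace ℝ (Fin 3) ≃ₗᵢ[ℝ] EuclideanSpace ℝ (Fin 3) :=
    LinearIsometryEquiv.piLpCongrRight 2 (fun i : Fin 3 =>
      if i = 2 then LinearIsometryEquiv.neg ℝ else LinearIsometryEquiv.refl ℝ ℝ) with hσ
  have hσY : ∀ Y : EuclideanSpace ℝ (Fin 3),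
      σ Y = Y - (2 * Y 2) • EuclideanSpace.single 2 (1 : ℝ) := by
    intro Y
    ext i
    fin_cases i <;> (simp [hσ, LinearIsometryEquiv.piLpCongrRight_apply]; try ring)
  have := σ.measurePreserving.integral_comp σ.toHomeomorph.measurableEmbedding f
  simp_rw [← hσY]
  exact this

/-- The Euclidean norm on `ℝ³` is at most the `ℓ¹` norm of the coordinates. [folklore] -/
theorem fluxSign_norm_le_coord (Y : EuclideanSpace ℝ (Fin 3)) : ‖Y‖ ≤ |Y 0| + |Y 1| + |Y 2| := by
  rw [EuclideanSpace.norm_eq Y, Fin.sum_univ_three, Real.sqrt_le_left (by positivity)]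
  simp only [Real.norm_eq_abs]
  nlinarith [abs_nonneg (Y 0), abs_nonneg (Y 1), abs_nonneg (Y 2), sq_abs (Y 0), sq_abs (Y 1),
    sq_abs (Y 2)]

/-- A function on `ℝ³` vanishing outside a coordinate box has compact support. [folklore] -/
theorem fluxSign_hasCompactSupport_of_box (f : EuclideanSpace ℝ (Fin 3) → ℝ)
    (hT : ∃ T : ℝ, ∀ Y, f Y ≠ 0 → |Y 0| + |Y 1| + |Y 2| ≤ T) : HasCompactSupport f := by
  obtain ⟨T, hT⟩ := hT
  refine HasCompactSupport.intro (isCompact_closedBall (0 : EuclideanSpace ℝ (Fin 3)) T) ?_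
  intro Y hY
  by_contra h
  exact hY (mem_closedBall_zero_iff.2 ((fluxSign_norm_le_coord Y).trans (hT Y h)))

/-- A compactly supported function on `ℝ` vanishes outside some `[-r, r]`. [folklore] -/
theorem fluxSign_exists_abs_le_of_hasCompactSupport {k : ℝ → ℝ} (hk : HasCompactSupport k) :
    ∃ r : ℝ, ∀ t, k t ≠ 0 → |t| ≤ r := by
  obtain ⟨r, hr⟩ := hk.isCompact.isBounded.subset_closedBall 0
  refine ⟨r, fun t ht => ?_⟩
  have : t ∈ Metric.closedBall (0 : ℝ) r := hr (subset_tsupport _ (mem_support.2 ht))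
  simpa [Real.dist_eq] using this

/-- Integer bi-periodicity from the two unit periods. [folklore] -/
theorem fluxSign_periodic_int {g : EuclideanSpace ℝ (Fin 3) → ℝ}
    (h0 : ∀ Y, g (Y + EuclideanSpace.single 0 (1 : ℝ)) = g Y)
    (h1 : ∀ Y, g (Y + EuclideanSpace.single 1 (1 : ℝ)) = g Y) (a b : ℤ)
    (Y : EuclideanSpace ℝ (Fin 3)) :
    g (Y + ((a : ℝ) • EuclideanSpace.single 0 (1 : ℝ) + (b : ℝ) • EuclideanSpace.single 1 (1 : ℝ)))
      = g Y := by
  have hz : ∀ (v : EuclideanSpace ℝ (Fin 3)), (∀ Z, g (Z + v) = g Z) →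
      ∀ (n : ℤ) (Z : EuclideanSpace ℝ (Fin 3)), g (Z + (n : ℝ) • v) = g Z := by
    intro v hv n
    induction n using Int.induction_on with
    | zero => intro Z; simp
    | succ n ih =>
        intro Z
        have : Z + (((n : ℤ) + 1 : ℤ) : ℝ) • v = (Z + ((n : ℤ) : ℝ) • v) + v := by
          push_cast; rw [add_smul, one_smul, add_assoc]
        rw [this, hv, ih]
    | pred n ih =>
        intro Z
        have key := hv (Z + ((-(n : ℤ) - 1 : ℤ) : ℝ) • v)
        have : Z + ((-(n : ℤ) - 1 : ℤ) : ℝ) • v + v = Z + ((-(n : ℤ) : ℤ) : ℝ) • v := by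
          push_cast; rw [add_assoc, sub_smul, one_smul, sub_add_cancel]
        rw [this, ih] at key
        exact key.symm
  rw [← add_assoc, hz _ h1 b, hz _ h0 a]

/-- **Horizontal telescoping.** For a continuous compactly supported profile `k`, a continuous
integrand `g` on `ℝ³` supported in a horizontal slab and `1`-periodic in `Y₀` and `Y₁`, the
plateau cut-offs `Σ_{j<2R} k(Y₀+R−j)`, `Σ_{j<2R} k(Y₁+R−j)` average `g` exactly:
`∫ (Σk)(Σk) g = (2R)² ∫ k(Y₀)k(Y₁) g` (translation invariance of Lebesgue measure). [folklore] -/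
theorem fluxSign_integral_telescope (k : ℝ → ℝ) (g : EuclideanSpace ℝ (Fin 3) → ℝ) (R : ℕ)
    (hk : Continuous k) (hkc : HasCompactSupport k) (hg : Continuous g)
    (hT : ∃ T : ℝ, ∀ Y, g Y ≠ 0 → |Y 2| ≤ T)
    (h0 : ∀ Y, g (Y + EuclideanSpace.single 0 (1 : ℝ)) = g Y)
    (h1 : ∀ Y, g (Y + EuclideanSpace.single 1 (1 : ℝ)) = g Y) :
    ∫ Y : EuclideanSpace ℝ (Fin 3),
        (∑ j ∈ Finset.range (2 * R), k (Y 0 + (R : ℝ) - (j : ℝ))) *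
          (∑ j ∈ Finset.range (2 * R), k (Y 1 + (R : ℝ) - (j : ℝ))) * g Y =
      (2 * (R : ℝ)) ^ 2 * ∫ Y : EuclideanSpace ℝ (Fin 3), k (Y 0) * k (Y 1) * g Y := by
  set e0 : EuclideanSpace ℝ (Fin 3) := EuclideanSpace.single 0 (1 : ℝ) with he0
  set e1 : EuclideanSpace ℝ (Fin 3) := EuclideanSpace.single 1 (1 : ℝ) with he1
  obtain ⟨T, hT⟩ := hT
  obtain ⟨r, hr⟩ := fluxSign_exists_abs_le_of_hasCompactSupport hkc
  have hc0 : Continuous fun Y : EuclideanSpace ℝ (Fin 3) => Y 0 :=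
    PiLp.continuous_apply 2 (fun _ : Fin 3 => ℝ) 0
  have hc1 : Continuous fun Y : EuclideanSpace ℝ (Fin 3) => Y 1 :=
    PiLp.continuous_apply 2 (fun _ : Fin 3 => ℝ) 1
  -- integrability of the translated pieces
  have hint : ∀ a b : ℝ, Integrable (fun Y : EuclideanSpace ℝ (Fin 3) =>
      k (Y 0 + a) * k (Y 1 + b) * g Y) := by
    intro a b
    refine Continuous.integrable_of_hasCompactSupport
      (((hk.comp (hc0.add continuous_const)).mul (hk.comp (hc1.add continuous_const))).mul hg) ?_
    refine fluxSign_hasCompactSupport_of_box _ ⟨(r + |a|) + (r + |b|) + T, fun Y hY => ?_⟩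
    have hY1 : k (Y 0 + a) ≠ 0 := fun h => hY (by rw [h, zero_mul, zero_mul])
    have hY2 : k (Y 1 + b) ≠ 0 := fun h => hY (by rw [h, mul_zero, zero_mul])
    have hY3 : g Y ≠ 0 := fun h => hY (by rw [h, mul_zero])
    have h1' := hr _ hY1
    have h2' := hr _ hY2
    have h3' := hT _ hY3
    have ha : |Y 0| ≤ r + |a| := by
      have := abs_add_le (Y 0 + a) (-a)
      rw [abs_neg, add_neg_cancel_right] at this
      linarith
    have hb : |Y 1| ≤ r + |b| := by
      have := abs_add_le (Y 1 + b) (-b)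
      rw [abs_neg, add_neg_cancel_right] at this
      linarith
    linarith
  have hint' : ∀ j l : ℕ, Integrable (fun Y : EuclideanSpace ℝ (Fin 3) =>
      k (Y 0 + (R : ℝ) - (j : ℝ)) * k (Y 1 + (R : ℝ) - (l : ℝ)) * g Y) := by
    intro j l
    simpa only [add_sub_assoc] using hint ((R : ℝ) - j) ((R : ℝ) - l)
  -- the translation step
  have hstep : ∀ j l : ℕ,
      ∫ Y : EuclideanSpace ℝ (Fin 3), k (Y 0 + (R : ℝ) - (j : ℝ)) * k (Y 1 + (R : ℝ) - (l : ℝ)) * g Y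
        = ∫ Y : EuclideanSpace ℝ (Fin 3), k (Y 0) * k (Y 1) * g Y := by
    intro j l
    set v : EuclideanSpace ℝ (Fin 3) := ((R : ℝ) - j) • e0 + ((R : ℝ) - l) • e1 with hv
    have hv0 : v 0 = (R : ℝ) - j := by simp [hv, he0, he1]
    have hv1 : v 1 = (R : ℝ) - l := by simp [hv, he0, he1]
    have hper : ∀ Y, g (Y - v) = g Y := by
      intro Y
      have := fluxSign_periodic_int h0 h1 (-((R : ℤ) - j)) (-((R : ℤ) - l)) Y
      rw [← this]
      congr 1
      rw [hv, he0, he1]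
      push_cast
      module
    have key := integral_add_right_eq_self (μ := (volume : Measure (EuclideanSpace ℝ (Fin 3))))
      (fun Y : EuclideanSpace ℝ (Fin 3) => k (Y 0) * k (Y 1) * g (Y - v)) v
    simp only [PiLp.add_apply, hv0, hv1, add_sub_cancel_right] at key
    simp_rw [hper] at key
    rw [← key]
    congr 1
    funext Y
    rw [add_sub_assoc, add_sub_assoc]
  -- expand and sum
  have hexp : ∀ Y : EuclideanSpace ℝ (Fin 3),
      (∑ j ∈ Finset.range (2 * R), k (Y 0 + (R : ℝ) - (j : ℝ))) *
          (∑ j ∈ Finset.range (2 * R), k (Y 1 + (R : ℝ) - (j : ℝ))) * g Y =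
        ∑ j ∈ Finset.range (2 * R), ∑ l ∈ Finset.range (2 * R),
          k (Y 0 + (R : ℝ) - (j : ℝ)) * k (Y 1 + (R : ℝ) - (l : ℝ)) * g Y := by
    intro Y
    rw [Finset.sum_mul_sum, Finset.sum_mul]
    refine Finset.sum_congr rfl fun j _ => ?_
    rw [Finset.sum_mul]
  simp_rw [hexp]
  rw [integral_finsetSum _ (fun j _ => integrable_finsetSum _ (fun l _ => hint' j l))]
  simp_rw [integral_finsetSum _ (fun l _ => hint' _ l), hstep]
  simp only [Finset.sum_const, Finset.card_range, nsmul_eq_mul]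
  push_cast
  ring

/-- **Unit-cell averaging in one variable.** If `k` is continuous, vanishes off `(0, 2)` at the
ends (`k = 0` on `t ≤ 0` and on `t ≥ 2`) and `k(t) + k(t+1) = 1` on `[0, 1]` (a two-cell
partition of unity), then `∫ k h = ∫₀¹ h` for every continuous `1`-periodic `h`. [folklore] -/
theorem fluxSign_cell_average_one (k h : ℝ → ℝ) (hk : Continuous k) (hh : Continuous h)
    (hk0 : ∀ t, t ≤ 0 → k t = 0) (hk2 : ∀ t, 2 ≤ t → k t = 0)
    (hk1 : ∀ t, 0 ≤ t → t ≤ 1 → k t + k (t + 1) = 1) (hper : ∀ t, h (t + 1) = h t) :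
    ∫ t, k t * h t = ∫ t in (0 : ℝ)..1, h t := by
  have hsupp : support (fun t => k t * h t) ⊆ Ioc (0 : ℝ) 2 := by
    intro t ht
    rw [mem_support] at ht
    refine ⟨?_, ?_⟩
    · by_contra h0
      exact ht (by rw [hk0 t (not_lt.1 h0), zero_mul])
    · by_contra h2
      exact ht (by rw [hk2 t (le_of_lt (not_le.1 h2)), zero_mul])
  rw [← intervalIntegral.integral_eq_integral_of_support_subset hsupp]
  have hkh : ∀ a b : ℝ, IntervalIntegrable (fun t => k t * h t) volume a b := fun a b =>
    (hk.mul hh).intervalIntegrable a b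
  rw [← intervalIntegral.integral_add_adjacent_intervals (hkh 0 1) (hkh 1 2)]
  have h2 : ∫ t in (1 : ℝ)..2, k t * h t = ∫ t in (0 : ℝ)..1, k (t + 1) * h t := by
    have := intervalIntegral.integral_comp_add_right (fun t => k t * h t) (1 : ℝ) (a := 0) (b := 1)
    simp only [zero_add, one_add_one_eq_two] at this
    rw [← this]
    simp_rw [hper]
  have hc2 : Continuous fun t => k (t + 1) * h t := (hk.comp (continuous_add_const 1)).mul hh
  rw [h2, ← intervalIntegral.integral_add (hkh 0 1) (hc2.intervalIntegrable 0 1)]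
  refine intervalIntegral.integral_congr fun t ht => ?_
  rw [uIcc_of_le zero_le_one] at ht
  have := hk1 t ht.1 ht.2
  calc k t * h t + k (t + 1) * h t = (k t + k (t + 1)) * h t := by ring
    _ = h t := by rw [this, one_mul]

/-- **Unit-cell averaging in two variables.** With `k` as in `fluxSign_cell_average_one` and
`h` continuous and `1`-periodic in both variables, `∫∫ k(a)k(b)h(a,b) = ∫_{[0,1]²} h`
(Fubini twice). [folklore] -/
theorem fluxSign_cell_average_two (k : ℝ → ℝ) (h : ℝ × ℝ → ℝ) (hk : Continuous k)
    (hh : Continuous h) (hk0 : ∀ t, t ≤ 0 → k t = 0) (hk2 : ∀ t, 2 ≤ t → k t = 0)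
    (hk1 : ∀ t, 0 ≤ t → t ≤ 1 → k t + k (t + 1) = 1)
    (hper1 : ∀ q : ℝ × ℝ, h (q.1 + 1, q.2) = h q) (hper2 : ∀ q : ℝ × ℝ, h (q.1, q.2 + 1) = h q) :
    ∫ q : ℝ × ℝ, k q.1 * k q.2 * h q = ∫ q in Set.Icc (0 : ℝ) 1 ×ˢ Set.Icc (0 : ℝ) 1, h q := by
  -- integrability on `ℝ²`
  have hF : Integrable (fun q : ℝ × ℝ => k q.1 * k q.2 * h q) (volume.prod volume) := by
    have hc : Continuous fun q : ℝ × ℝ => k q.1 * k q.2 * h q :=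
      ((hk.comp continuous_fst).mul (hk.comp continuous_snd)).mul hh
    refine hc.integrable_of_hasCompactSupport ?_
    refine HasCompactSupport.of_support_subset_isCompact
      ((isCompact_Icc (a := (0 : ℝ)) (b := 2)).prod (isCompact_Icc (a := (0 : ℝ)) (b := 2))) ?_
    intro q hq
    rw [mem_support] at hq
    have h1 : k q.1 ≠ 0 := fun h0 => hq (by rw [h0, zero_mul, zero_mul])
    have h2 : k q.2 ≠ 0 := fun h0 => hq (by rw [h0, mul_zero, zero_mul])
    refine ⟨⟨?_, ?_⟩, ⟨?_, ?_⟩⟩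
    · by_contra hc'; exact h1 (hk0 _ (le_of_lt (not_le.1 hc')))
    · by_contra hc'; exact h1 (hk2 _ (le_of_lt (not_le.1 hc')))
    · by_contra hc'; exact h2 (hk0 _ (le_of_lt (not_le.1 hc')))
    · by_contra hc'; exact h2 (hk2 _ (le_of_lt (not_le.1 hc')))
  rw [Measure.volume_eq_prod, integral_prod _ hF]
  -- the inner integral
  have hinner : ∀ a : ℝ, ∫ b, k (a, b).1 * k (a, b).2 * h (a, b) =
      k a * ∫ b in (0 : ℝ)..1, h (a, b) := by
    intro a
    simp only
    rw [← fluxSign_cell_average_one k (fun b => h (a, b)) hk (hh.comp (Continuous.prodMk_right a))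
      hk0 hk2 hk1 (fun b => hper2 (a, b)), ← integral_const_mul]
    congr 1
    funext b
    ring
  simp_rw [hinner]
  -- the outer integral
  have hHc : Continuous fun a : ℝ => ∫ b in (0 : ℝ)..1, h (a, b) :=
    intervalIntegral.continuous_parametric_intervalIntegral_of_continuous' (f := fun a b => h (a, b))
      hh 0 1
  rw [fluxSign_cell_average_one k _ hk hHc hk0 hk2 hk1 (fun a =>
    intervalIntegral.integral_congr fun b _ => hper1 (a, b))]
  -- back to the set integral
  have hI : IntegrableOn h (Set.Icc (0 : ℝ) 1 ×ˢ Set.Icc (0 : ℝ) 1) (volume.prod volume) :=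
    hh.continuousOn.integrableOn_compact (isCompact_Icc.prod isCompact_Icc)
  rw [setIntegral_prod h hI, intervalIntegral.integral_of_le zero_le_one,
    ← integral_Icc_eq_integral_Ioc]
  refine setIntegral_congr_fun measurableSet_Icc fun a _ => ?_
  rw [intervalIntegral.integral_of_le zero_le_one, ← integral_Icc_eq_integral_Ioc]

/-- Registered tools stub of `stub_fluxSign` (line Sketch of crux `DyadicRealisation`): the
conjunction of the integration-engine lemmas of this file. [folklore] -/
theorem stub_fluxSignTools :
    (∀ f : EuclideanSpace ℝ (Fin 3) → ℝ, ∫ Y, f Y = ∫ w : ℝ × ℝ × ℝ, f !₂[w.2.1, w.2.2, w.1]) ∧ (∀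
    (g : ℝ × ℝ → ℝ) (h : ℝ → ℝ), ∫ Y : EuclideanSpace ℝ (Fin 3), g (Y 0, Y 1) * h (Y 2) = (∫ q : ℝ ×
    ℝ, g q) * ∫ s : ℝ, h s) ∧ (∀ f : EuclideanSpace ℝ (Fin 3) → ℝ, ∫ Y : EuclideanSpace ℝ (Fin 3), f
    (Y - (2 * Y 2) • EuclideanSpace.single 2 (1 : ℝ)) = ∫ Y, f Y) ∧ (∀ Y : EuclideanSpace ℝ (Fin 3),
    ‖Y‖ ≤ |Y 0| + |Y 1| + |Y 2|) ∧ (∀ f : EuclideanSpace ℝ (Fin 3) → ℝ, (∃ T : ℝ, ∀ Y, f Y ≠ 0 → |Y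
    0| + |Y 1| + |Y 2| ≤ T) → HasCompactSupport f) ∧ (∀ (k : ℝ → ℝ) (g : EuclideanSpace ℝ (Fin 3) →
    ℝ) (R : ℕ), Continuous k → HasCompactSupport k → Continuous g → (∃ T : ℝ, ∀ Y, g Y ≠ 0 → |Y 2| ≤
    T) → (∀ Y, g (Y + EuclideanSpace.single 0 (1 : ℝ)) = g Y) → (∀ Y, g (Y + EuclideanSpace.single 1
    (1 : ℝ)) = g Y) → ∫ Y : EuclideanSpace ℝ (Fin 3), (∑ j ∈ Finset.range (2 * R), k (Y 0 + (R : ℝ)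
    - (j : ℝ))) * (∑ j ∈ Finset.range (2 * R), k (Y 1 + (R : ℝ) - (j : ℝ))) * g Y = (2 * (R : ℝ)) ^
    2 * ∫ Y : EuclideanSpace ℝ (Fin 3), k (Y 0) * k (Y 1) * g Y) ∧ (∀ (k h : ℝ → ℝ), Continuous k →
    Continuous h → (∀ t, t ≤ 0 → k t = 0) → (∀ t, 2 ≤ t → k t = 0) → (∀ t, 0 ≤ t → t ≤ 1 → k t + k
    (t + 1) = 1) → (∀ t, h (t + 1) = h t) → ∫ t, k t * h t = ∫ t in (0 : ℝ)..1, h t) ∧ (∀ (k : ℝ →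
    ℝ) (h : ℝ × ℝ → ℝ), Continuous k → Continuous h → (∀ t, t ≤ 0 → k t = 0) → (∀ t, 2 ≤ t → k t =
    0) → (∀ t, 0 ≤ t → t ≤ 1 → k t + k (t + 1) = 1) → (∀ q : ℝ × ℝ, h (q.1 + 1, q.2) = h q) → (∀ q :
    ℝ × ℝ, h (q.1, q.2 + 1) = h q) → ∫ q : ℝ × ℝ, k q.1 * k q.2 * h q = ∫ q in Set.Icc (0 : ℝ) 1 ×ˢ
    Set.Icc (0 : ℝ) 1, h q) :=
  ⟨fluxSign_integral_coord, fluxSign_integral_mul_split, fluxSign_integral_reflect,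
    fluxSign_norm_le_coord, fluxSign_hasCompactSupport_of_box, fluxSign_integral_telescope,
    fluxSign_cell_average_one, fluxSign_cell_average_two⟩

end Summit.AnomalousDissipation.AnomalousDissipation.Theorems
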